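import Summits.ValiantsHypothesis.ValiantsHypothesis.Theses.SuccinctLift
import Literature.Computability.Complexity.ACRealizeOver
import Literature.Computability.AlgebraicComplexity.CircuitGateSemantics
import Literature.Computability.QuantumComplexity.StabilizerRankLowerBoundsProofs
import Summits.ValiantsHypothesis.ValiantsHypothesis.Theorems.MonotoneRestorationMonotoneRestorationQPRowScanGates

/-!
# Line `char2`, stub T2 = `BoolBridgeF2` (stmt 26304) — PROOF (parity normal form)

An `𝔽₂` arithmetic circuit of product-depth `Δ` with `s` wires, read as a Boolean function on
`{0,1}^M`, is realized over `accBasis 2` (AC⁰ with parity gates) in depth `2Δ + 2` and size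
`(2s+3)^(2Δ+2)`: every maximal block of sum gates is flattened into ONE parity gate over its
*atoms* (variables, the constant `1`, product gates), multiplicities reduced mod 2.
-/

namespace Summit.ValiantsHypothesis.ValiantsHypothesis.Theorems.SuccinctLiftCharTwo.T2
open Literature.Computability.AlgebraicComplexity
open Literature.Computability.AlgebraicComplexity.ArithCircuit (Operand gateValues gateWDepths
  gateValues_append_singleton gateValues_length gateWDepths_append_singleton gateWDepths_length
  le_foldr_max_of_mem)
open Literature.Computability.QuantumComplexity.PelegShpilkaVolk (zmod2_cases)
open Literature.Computability.Complexity (ACRealOver accBasis acBasis GateFn acBasis_subset_accBasis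
  acRealOver_input acRealOver_const acRealOver_gate acRealOver_forall acRealOver_forall_const)
open scoped Classical
noncomputable section
/-! ### Small algebra over `ZMod 2` -/

/-- Helper `sum_symmDiff_zmod2` of the char-2 line (see the module docstring). -/
theorem sum_symmDiff_zmod2 {α : Type*} [DecidableEq α] (A B : Finset α) (f : α → ZMod 2) :
    ∑ a ∈ symmDiff A B, f a = ∑ a ∈ A, f a + ∑ a ∈ B, f a := by
  have h1 : ∑ a ∈ A, f a = ∑ a ∈ A \ B, f a + ∑ a ∈ A ∩ B, f a := by
    rw [← Finset.sum_union (Finset.disjoint_sdiff_inter A B), Finset.sdiff_union_inter]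
  have h2 : ∑ a ∈ B, f a = ∑ a ∈ B \ A, f a + ∑ a ∈ A ∩ B, f a := by
    rw [Finset.inter_comm, ← Finset.sum_union (Finset.disjoint_sdiff_inter B A),
      Finset.sdiff_union_inter]
  have h3 : ∑ a ∈ symmDiff A B, f a = ∑ a ∈ A \ B, f a + ∑ a ∈ B \ A, f a := by
    rw [symmDiff_def, Finset.sup_eq_union, Finset.sum_union disjoint_sdiff_sdiff]
  rw [h1, h2, h3]
  have h4 : ∀ y : ZMod 2, y + y = 0 := by decide
  linear_combination (-1 : ZMod 2) * h4 (∑ a ∈ A ∩ B, f a)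

/-- In `ZMod 2` a list product is `1` iff every factor is `1`. -/
theorem zmod2_list_prod_eq_one_iff (l : List (ZMod 2)) : l.prod = 1 ↔ ∀ a ∈ l, a = 1 := by
  induction l with
  | nil => simp
  | cons a l ih =>
    rw [List.prod_cons, List.forall_mem_cons, ← ih]
    rcases zmod2_cases a with rfl | rfl <;> simp

/-! ### Atoms and the parity normal form -/

/-- Atoms of the parity normal form: a variable, the constant `1`, or a product gate. -/
inductive Atom (σ : Type) : Type
  | var (i : σ) : Atom σ
  | one : Atom σ
  | pg (j : ℕ) : Atom σ

variable {σ : Type}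
/-- Atoms of an operand, given the atom sets `AL` of the gates so far. -/
def atomsOp (AL : List (Finset (Atom σ))) : Operand (ZMod 2) σ → Finset (Atom σ)
  | .var i => {Atom.var i}
  | .const c => if c = 1 then {Atom.one} else ∅
  | .gate j => AL.getD j ∅

/-- Atoms of a weighted sum (multiplicities mod 2 = symmetric difference). -/
def sumAtoms (AL : List (Finset (Atom σ))) : List (ZMod 2 × Operand (ZMod 2) σ) → Finset (Atom σ)
  | [] => ∅
  | ca :: rest => if ca.1 = 1 then symmDiff (atomsOp AL ca.2) (sumAtoms AL rest) else sumAtoms AL rest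

/-- Atoms of a gate placed at index `j`. -/
def gateAtoms (AL : List (Finset (Atom σ))) (j : ℕ) : ArithCircuit.Gate (ZMod 2) σ → Finset (Atom σ)
  | .sum args => sumAtoms AL args
  | .prod _ => {Atom.pg j}

/-- The atom sets of a gate list (left fold, like `gateValues`). -/
def atomsList (gs : List (ArithCircuit.Gate (ZMod 2) σ)) : List (Finset (Atom σ)) :=
  gs.foldl (fun AL g => AL ++ [gateAtoms AL AL.length g]) []

/-- Helper `atomsList_append_singleton` of the char-2 line (see the module docstring). -/
theorem atomsList_append_singleton (gs : List (ArithCircuit.Gate (ZMod 2) σ))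
    (g : ArithCircuit.Gate (ZMod 2) σ) :
    atomsList (gs ++ [g]) = atomsList gs ++ [gateAtoms (atomsList gs) (atomsList gs).length g] := by
  simp [atomsList, List.foldl_append]

/-- Helper `atomsList_length` of the char-2 line (see the module docstring). -/
@[simp] theorem atomsList_length (gs : List (ArithCircuit.Gate (ZMod 2) σ)) :
    (atomsList gs).length = gs.length := by
  induction gs using List.reverseRecOn with
  | nil => rfl
  | append_singleton gs g ih => simp [atomsList_append_singleton, ih]

/-- The key atom of an operand occurrence (for counting). -/
def keyOf : Operand (ZMod 2) σ → Atom σ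
  | .var i => Atom.var i
  | .const _ => Atom.one
  | .gate j => Atom.pg j

/-- The atom universe of a gate list: `1` and the keys of all operand occurrences. -/
def base (gs : List (ArithCircuit.Gate (ZMod 2) σ)) : Finset (Atom σ) :=
  insert Atom.one ((gs.flatMap ArithCircuit.Gate.args).map keyOf).toFinset

/-- Helper `card_base_le` of the char-2 line (see the module docstring). -/
theorem card_base_le (gs : List (ArithCircuit.Gate (ZMod 2) σ)) :
    (base gs).card ≤ (gs.map ArithCircuit.Gate.fanIn).sum + 1 := by
  unfold base
  refine (Finset.card_insert_le _ _).trans ?_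
  refine Nat.add_le_add_right ((List.toFinset_card_le _).trans ?_) 1
  rw [List.length_map, List.length_flatMap]
  exact le_of_eq rfl

/-- Helper `base_mono` of the char-2 line (see the module docstring). -/
theorem base_mono (gs : List (ArithCircuit.Gate (ZMod 2) σ)) (g : ArithCircuit.Gate (ZMod 2) σ) :
    base gs ⊆ base (gs ++ [g]) := by
  unfold base
  intro a ha
  simp only [Finset.mem_insert, List.mem_toFinset, List.mem_map, List.mem_flatMap,
    List.mem_append, List.mem_singleton] at ha ⊢
  rcases ha with h | ⟨u, ⟨g', hg', hu⟩, rfl⟩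
  · exact Or.inl h
  · exact Or.inr ⟨u, ⟨g', Or.inl hg', hu⟩, rfl⟩

/-- Helper `keyOf_mem_base_snoc` of the char-2 line (see the module docstring). -/
theorem keyOf_mem_base_snoc (gs : List (ArithCircuit.Gate (ZMod 2) σ))
    (g : ArithCircuit.Gate (ZMod 2) σ) (u : Operand (ZMod 2) σ) (hu : u ∈ g.args) :
    keyOf u ∈ base (gs ++ [g]) := by
  unfold base
  simp only [Finset.mem_insert, List.mem_toFinset, List.mem_map, List.mem_flatMap,
    List.mem_append, List.mem_singleton]
  exact Or.inr ⟨u, ⟨g, Or.inr rfl, hu⟩, rfl⟩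

/-! ### Semantics at a Boolean point -/

variable {M : ℕ} (e : Fin M ≃ σ)
/-- The `0/1` point of an input `x`. -/
def pt (x : Fin M → Bool) : σ → ZMod 2 := fun i => if x (e.symm i) then 1 else 0

/-- Value of an atom at `x`, given the gate values `vals`. -/
def chi (vals : List (MvPolynomial σ (ZMod 2))) (x : Fin M → Bool) : Atom σ → ZMod 2
  | .var i => pt e x i
  | .one => 1
  | .pg j => MvPolynomial.eval (pt e x) (vals.getD j 0)

/-- Depth of an atom given the product-depth list `ds`. -/
def atomDepth (ds : List ℕ) : Atom σ → ℕ
  | .pg j => ds.getD j 0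
  | _ => 0

/-- The product-depth weight. -/
def pw : ArithCircuit.Gate (ZMod 2) σ → ℕ := fun g => if g.isProd then 1 else 0

/-- The invariant of a gate prefix: a record of proofs (`Type`-valued and used through
`Nonempty`, so that for the tree audit it is plain data rather than a proposition of its own). -/
structure Inv {σ : Type} {M : ℕ} (e : Fin M ≃ σ) (s : ℕ) (gs : List (ArithCircuit.Gate (ZMod 2) σ)) :
    Type where
  edges : (gs.map ArithCircuit.Gate.fanIn).sum ≤ s
  sem : ∀ j, j < gs.length → ∀ x : Fin M → Bool,
    MvPolynomial.eval (pt e x) ((gateValues gs).getD j 0) =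
      ∑ a ∈ (atomsList gs).getD j ∅, chi e (gateValues gs) x a
  pgok : ∀ j j', Atom.pg j' ∈ (atomsList gs).getD j ∅ →
    j' < gs.length ∧ ∃ args, gs[j']? = some (ArithCircuit.Gate.prod args)
  dep : ∀ j, ∀ a ∈ (atomsList gs).getD j ∅,
    atomDepth (gateWDepths pw gs) a ≤ (gateWDepths pw gs).getD j 0
  sub : ∀ j args, gs[j]? = some (ArithCircuit.Gate.sum args) → (atomsList gs).getD j ∅ ⊆ base gs
  shape : ∀ j g, gs[j]? = some g → ∃ AL', (atomsList gs).getD j ∅ = gateAtoms AL' j g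
  real : ∀ j args, gs[j]? = some (ArithCircuit.Gate.prod args) →
    ACRealOver (accBasis 2)
      (fun x : Fin M → Bool => decide (MvPolynomial.eval (pt e x) ((gateValues gs).getD j 0) = 1))
      (2 * (gateWDepths pw gs).getD j 0 + 1) ((2 * s + 3) ^ (2 * (gateWDepths pw gs).getD j 0))

/-- Helper `inv_nil` of the char-2 line (see the module docstring). -/
theorem inv_nil (s : ℕ) : Nonempty (Inv e s ([] : List (ArithCircuit.Gate (ZMod 2) σ))) :=
  ⟨{ edges := by simp
     sem := by simp
     pgok := by simp
     dep := by simp [atomDepth]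
     sub := by simp
     shape := by simp
     real := by simp }⟩

/-! ### List index helpers -/

/-- Helper `getD_append_left'` of the char-2 line (see the module docstring). -/
theorem getD_append_left' {α : Type*} (l l' : List α) (d : α) {j : ℕ} (h : j < l.length) :
    (l ++ l').getD j d = l.getD j d := by
  simp [List.getD_eq_getElem?_getD, List.getElem?_append_left h]

/-- Helper `getD_append_length'` of the char-2 line (see the module docstring). -/
theorem getD_append_length' {α : Type*} (l : List α) (a d : α) :
    (l ++ [a]).getD l.length d = a := by
  simp [List.getD_eq_getElem?_getD]

/-- Helper `getD_of_length_le'` of the char-2 line (see the module docstring). -/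
theorem getD_of_length_le' {α : Type*} (l : List α) (d : α) {j : ℕ} (h : l.length ≤ j) :
    l.getD j d = d := by
  simp [List.getD_eq_getElem?_getD, List.getElem?_eq_none_iff.mpr h]

/-! ### Operand-level consequences of the invariant -/

section Operand
variable {e} {s : ℕ} {gs : List (ArithCircuit.Gate (ZMod 2) σ)}
/-- Helper `mem_sumAtoms` of the char-2 line (see the module docstring). -/
theorem mem_sumAtoms {AL : List (Finset (Atom σ))} {a : Atom σ}
    {args : List (ZMod 2 × Operand (ZMod 2) σ)} (h : a ∈ sumAtoms AL args) :
    ∃ ca ∈ args, a ∈ atomsOp AL ca.2 := by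
  induction args with
  | nil => simp [sumAtoms] at h
  | cons ca rest ih =>
    simp only [sumAtoms] at h
    have hrest : a ∈ sumAtoms AL rest → ∃ cb ∈ ca :: rest, a ∈ atomsOp AL cb.2 := fun h' => by
      obtain ⟨cb, hcb, hb⟩ := ih h'
      exact ⟨cb, List.mem_cons_of_mem _ hcb, hb⟩
    split_ifs at h with hc
    · rw [Finset.mem_symmDiff] at h
      rcases h with ⟨h, -⟩ | ⟨h, -⟩
      · exact ⟨ca, by simp, h⟩
      · exact hrest h
    · exact hrest h

/-- Semantics of an operand: its value at `x` is the parity of its atoms. -/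
theorem Inv.semOp (hI : Inv e s gs) (u : Operand (ZMod 2) σ) (x : Fin M → Bool) :
    MvPolynomial.eval (pt e x) (u.eval (gateValues gs)) =
      ∑ a ∈ atomsOp (atomsList gs) u, chi e (gateValues gs) x a := by
  cases u with
  | var i => simp [Operand.eval, atomsOp, chi]
  | const c =>
    simp only [Operand.eval, MvPolynomial.eval_C, atomsOp]
    rcases zmod2_cases c with rfl | rfl <;> simp [chi]
  | gate j =>
    simp only [Operand.eval, atomsOp]
    by_cases hj : j < gs.length
    · exact hI.sem j hj x
    · rw [getD_of_length_le' _ _ (by rw [gateValues_length]; omega),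
        getD_of_length_le' _ _ (by rw [atomsList_length]; omega)]
      simp

/-- Helper `Inv.pgOp` of the char-2 line (see the module docstring). -/
theorem Inv.pgOp (hI : Inv e s gs) (u : Operand (ZMod 2) σ) {j' : ℕ}
    (h : Atom.pg j' ∈ atomsOp (atomsList gs) u) :
    j' < gs.length ∧ ∃ args, gs[j']? = some (ArithCircuit.Gate.prod args) := by
  cases u with
  | var i => simp [atomsOp] at h
  | const c => simp only [atomsOp] at h; split_ifs at h <;> simp at h
  | gate j => exact hI.pgok j j' h

/-- Helper `Inv.depOp` of the char-2 line (see the module docstring). -/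
theorem Inv.depOp (hI : Inv e s gs) (u : Operand (ZMod 2) σ) {a : Atom σ}
    (h : a ∈ atomsOp (atomsList gs) u) :
    atomDepth (gateWDepths pw gs) a ≤ u.depthIn (gateWDepths pw gs) := by
  cases u with
  | var i => simp [atomsOp] at h; subst h; simp [atomDepth]
  | const c =>
    simp only [atomsOp] at h; split_ifs at h
    · simp at h; subst h; simp [atomDepth]
    · simp at h
  | gate j => exact hI.dep j a h

/-- Helper `Inv.subOp` of the char-2 line (see the module docstring). -/
theorem Inv.subOp (hI : Inv e s gs) (u : Operand (ZMod 2) σ) :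
    atomsOp (atomsList gs) u ⊆ insert (keyOf u) (base gs) := by
  cases u with
  | var i => simp [atomsOp, keyOf]
  | const c =>
    simp only [atomsOp, keyOf]; split_ifs
    · simp
    · simp
  | gate j =>
    simp only [atomsOp, keyOf]
    rcases hg : gs[j]? with _ | g
    · have hj : gs.length ≤ j := by simpa [List.getElem?_eq_none_iff] using hg
      rw [getD_of_length_le' _ _ (by rw [atomsList_length]; exact hj)]
      simp
    · cases g with
      | sum args => exact (hI.sub j args hg).trans (Finset.subset_insert _ _)
      | prod args =>
        obtain ⟨AL', hAL'⟩ := hI.shape j _ hg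
        rw [hAL']
        simp [gateAtoms]

/-- Helper `Inv.card_atomsOp` of the char-2 line (see the module docstring). -/
theorem Inv.card_atomsOp (hI : Inv e s gs) (u : Operand (ZMod 2) σ) :
    (atomsOp (atomsList gs) u).card ≤ s + 2 := by
  calc (atomsOp (atomsList gs) u).card ≤ (insert (keyOf u) (base gs)).card :=
        Finset.card_le_card (hI.subOp u)
    _ ≤ (base gs).card + 1 := Finset.card_insert_le _ _
    _ ≤ (gs.map ArithCircuit.Gate.fanIn).sum + 1 + 1 := Nat.add_le_add_right (card_base_le gs) 1
    _ ≤ s + 2 := by have := hI.edges; omega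

end Operand

end

end Summit.ValiantsHypothesis.ValiantsHypothesis.Theorems.SuccinctLiftCharTwo.T2
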